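import Summits.QuantumFields.YangMills.Theorems.BalabanUVNodesN16Stub1RoadOfSlotKey
import Summits.QuantumFields.YangMills.Theorems.BalabanUVNodesN16PinnedLooseMatchOfSupKey
import HarnessLib

/-!
# Balaban UV nodes, N16 width lane (N07 → N16 in-edge), file 21: THE SUP-KEY TWINS of dag-n16-e's DischargeTest v8 theorem (module 50)
# and of module 52's stub-1 ∕ K3⁸ roads

Explicit-unit helper of lineage `pub-ymgap-dag-n16-w1` (generation 7), keyed to K3⁸ `stmt-QuantumFields-27366`
(`SpineGivenEndpointR13SepCoPHV`, skeleton v6 b4e55110ab73e679).  COUNT-NEUTRAL: no statement item is closed, no stub of the v6 skeleton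
is discharged; `h5` (node N05) and the sup key (node N07 = [Balaban1985Variational] Thm 1 (8)+(10), uniformly in the run index) are
DISPLAYED HYPOTHESES asserted for no family; K3⁸ is OPEN and NOT claimed; N16 ∕ N05 ∕ N07 are NOT discharged here.

WHAT.  dag-n16-e's evidence `N16DischargeTestV8.lean` on 27366 and module 50
`…N16PinnedLooseMatchSqueezeClassRadius.exists_letters_g_n16HolderAtReading_loose_squeezeFull_of_h5_reg910Slot` derive node N16's share of
K3⁸ v6's stub-1 witness (letters `ℓ₃`, coupling letter `g > 0`, radius letter `B`, sup letter `c′`, THE END's rows, the MATCH row,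
`(C F).B₃ ≤ B F ∧ 2^78·L^12 ≤ B F`, node N19′'s nine-conjunct N16-letter block, `N16PinnedLoose 𝔯 ℓ₃ B → N16HolderAtReading 𝔯 β` at every
reading) from TWO in-edges: `stub_h5` and the slot key `stub_reg910Slot F := ∃ G C, RadiiMono ∧ interface ∧ (T9ˢ)(G, C)`; module 52
`…N16Stub1RoadOfSlotKey` composes that with dag-n27-w1's `…K3V6Stub1ProducerRoads` into v6 stub 1's TEXT and K3⁸ BY NAME (hypothesis form).
THIS FILE replaces, in all of them, the slot-key binder bundle `(G, hGm, hG, C, hR)` by node N07's debt in GAUGE-INVARIANT (8)+(10) currency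
(this lineage's file 18 `slotKeyBody_of_supKey`, one `choose` each): per family, constants `C F` (`(C F).B₃·(C F).a₁ ≤ 1∕64`), a letter
`0 ≤ c F ≤ (C F).B₃`, and supKey «covariant plaquette differences of every `((C F).B₃ε₁)`-class minimiser of run `k+1` at an `ε₁`-loose datum
are `≤ c F·ε₁·F.L^{−3(k+1)}`».
* §1 ★★ `exists_letters_g_n16HolderAtReading_loose_squeezeFull_of_h5_supKey` (module 50's conclusion VERBATIM) · ★ `…_of_h5_regularSupKey`
  (the same from `RegularSup`-type letters, `2c′ F ≤ (C F).B₃`).  So a DischargeTest v9 may display node N07's stub WITHOUT `G`, cubes or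
  gauges: `stub_supKey F := ∃ (C : B11Thm1.Consts) (c : ℝ), 0 ≤ c ∧ c ≤ C.B₃ ∧ C.B₃·C.a₁ ≤ 1∕64 ∧ supKey F C c`.
* §2 ★★ `stub1TextV_of_h5_supKey_match_of_rows` (v6 `stub_rates13HV` TEXT from `β ∈ ]2∕3,1[`, `g > 0`, `h5`, `C`, `c`, supKey, the U3 rows,
  def-W1's four kernel letters) · `spineGivenEndpointR13SepCoPHV_of_h5_supKey_of_rows_of_stub2TextV` (K3⁸ BY NAME ∘ module 52's road and
  v6 stub 2's text; hypothesis form) · ★★ `stub1TextV_of_h5_supKey_squeeze_of_rows` (no `g` input).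

Sources: [Balaban1985Variational] Thm 1 (8)–(10), p. 279 (the displayed hypothesis; NOT proved here).
-/

set_option autoImplicit false

open scoped BigOperators Matrix Matrix.Norms.L2Operator
open NormedSpace

namespace Summit.QuantumFields.YangMills.BalabanUVNodes.N16SupKeyRoads

open Literature.MathematicalPhysics.QuantumFieldTheory.Balaban1983to89
open Literature.MathematicalPhysics.QuantumFieldTheory.Balaban1983to89.T4Continuum (T4Family)
open B7Prop1Explicit B7Prop2Explicit MatrixLog UnitaryModel
open T4AveragingDeficitWall hiding Site Plane Plaq Bond
open B7Prop3Flat (c3)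
open B8LeafModelZd (ZdIdx)
open B8LeafModelZd3 (zdGF3)
open Node00 (NE3Letters₁₁ ne3NperOfRecord₁₁ MatA)
open Summit.QuantumFields.BalabanUV.T4Continuum
open MinimalActionSandwich (IsMinimiser)
open MinimalActionRate (sfClass)
open MinimalActionRefine (RegularSup gradConst)
open YMDAG.UVSplit (RateReading₁₃CoPH)
open Summit.QuantumFields.YangMills.BalabanUVNodes.N16PinnedLayer13CoPH (N16PinnedLoose N16LettersEnd N16HolderAtReading)
open Summit.QuantumFields.YangMills.BalabanUVNodes.N16PinnedLooseMatchSqueezeClassRadius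
  (exists_letters_g_n16HolderAtReading_loose_squeezeFull_of_h5_reg910Slot)
open Summit.QuantumFields.YangMills.BalabanUVNodes.N16SlotKeyOfSupData (slotKeyBody_of_supKey slotKeyBody_of_regularSupKey)
open Literature.MathematicalPhysics.QuantumFieldTheory.Balaban1983to89.B12Sec2to5 (betaPrime510)
open Literature.MathematicalPhysics.QuantumFieldTheory.Balaban1983to89.Node00.U3KernelLetters (PolLimitsExistOfRecord₁₃ WindowedNE9OfRecord₁₃ WindowedDecayOfRecord₁₃
  WindowedStepRateOfRecord₁₃)
open Node00 (Stage13HParams)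
open Summit.QuantumFields.BalabanUV.T4Continuum.Spine
open YMDAG.UVSplit (ShellSplit₁₃CoPH)
open Summit.QuantumFields.YangMills.Theorems.K3V5Defs
open Summit.QuantumFields.YangMills.Theorems.K3V6Defs
open Summit.QuantumFields.YangMills.BalabanUVNodes.N16Stub1RoadOfSlotKey
  (stub1TextV_of_h5_reg910Slot_match_of_rows spineGivenEndpointR13SepCoPHV_of_h5_reg910Slot_of_rows_of_stub2TextV stub1TextV_of_h5_reg910Slot_squeeze_of_rows)

noncomputable section

/-! ## §1 DischargeTest v8's conclusion from `h5` and the GAUGE-INVARIANT sup key -/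

section Producer

variable {N : ℕ} [NeZero N] {β : ℝ} (hβ0 : 0 ≤ β) (hβ1 : β ≤ 1)
include hβ0 hβ1

/-- ★★ **DischargeTest v8's THEOREM WITH THE SLOT KEY REPLACED BY THE SUP KEY** — module 50
`exists_letters_g_n16HolderAtReading_loose_squeezeFull_of_h5_reg910Slot` with its slot-key binders `(G, hGm, hG, C, hR)` produced, per family,
from constants `C F` (`(C F).B₃·(C F).a₁ ≤ 1∕64`), a letter `0 ≤ c F ≤ (C F).B₃` and the sup key «at every minimiser `U` over
`sfClass ((C F).B₃ε₁) (k+1)` with an `ε₁`-loose datum (`ε₁ ≤ (C F).a₁`), `‖Ad_{U(x,κ)} U(∂p_{x+e_κ;π}) − U(∂p_{x;π})‖ ≤ c F·ε₁·F.L^{−3(k+1)}`»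
(file 18 `slotKeyBody_of_supKey`; `F.L ≥ 2` from `F.hL`).  Conclusion VERBATIM module 50's (letters `ℓ₃`, `g = gradConst 4 ∘ c′ > 0`, `B`, `c′`,
THE END's rows, the MATCH row, `(C F).B₃ ≤ B F ∧ 2^78·L^12 ≤ B F`, node N19′'s nine N16-letter rows, the N16 conjunct at every loose-pinned reading).
[cite: Balaban1985Variational, Thm 1 (8)–(10) p.279] [folklore] -/
theorem exists_letters_g_n16HolderAtReading_loose_squeezeFull_of_h5_supKey
    (h5 : ∀ F : T4Family, letI : CStarAlgebra (Matrix (Fin N) (Fin N) ℂ) := {}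
      ∃ (len : Site 4 → ℝ) (c₁ c₁' B₁' cP C₂ B₀β : ℝ) (inp : B8.B9Inputs),
        (∀ v : Site 4, 0 < len v → 1 ≤ len v) ∧ (∀ μ : Fin 4, len (e μ) = 1) ∧ 0 < B₁' ∧ 5 * ((4 : ℕ) : ℝ) * F.L * inp.B₀ ≤ B₁' ∧ 0 < c₁' ∧
        (∀ α₀ α₁ : ℝ, 0 < α₀ → 0 < α₁ → α₀ + α₁ ≤ c₁' →
          α₀ + α₁ ≤ c₁ ∧ C0 4 * (2 * α₀) ≤ 1 / 3 ∧ 4 * α₀ ≤ c2' 4 F.L ∧ 16 * (B₁' * (α₀ + α₁)) ≤ 1 ∧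
          Real.exp (4 * (800 * (((4 : ℕ) : ℝ) + 1) ^ 2 * (((4 : ℕ) : ℝ) + 4)) * α₀) * (1 + 8 * (131072 * (((4 : ℕ) : ℝ) + 1) ^ 2) * (B₁' * (α₀ + α₁))) ≤ 2 ∧
          2 * (B₁' * (α₀ + α₁)) ≤ c3 4 F.L ∧ ((4 : ℕ) : ℝ) * F.L * α₁ ≤ 1 / 8 ∧ α₀ ≤ cP ∧ α₁ ≤ cP ∧ B₁' * (α₀ + α₁) ≤ cP ∧
          2 * (B₁' * (α₀ + α₁)) ^ 2 + 20 * ((4 : ℕ) : ℝ) * α₀ * (B₁' * (α₀ + α₁)) + 2 * C₂ * (B₁' * (α₀ + α₁)) ^ 2 ≤ α₀ + α₁) ∧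
        B8.Thm4Body c₁ B₁' (fun i : {i : ZdIdx 4 F.L // (∀ j, i.Ω j = Set.univ) ∧ (∀ m j, i.Λs m j = {_y | j = m}) ∧ (∀ m j, i.Λb m j = {_c | j = m}) ∧ i.η = ((F.L : ℝ)⁻¹) ^ i.k} => (zdGF3 (Matrix (Fin N) (Fin N) ℂ) F.L β len i.1).toGFData) ∧
        B8.Prop3Body cP 4 (F.L : ℝ) C₂ inp B₀β (fun i : {i : ZdIdx 4 F.L // (∀ j, i.Ω j = Set.univ) ∧ (∀ m j, i.Λs m j = {_y | j = m}) ∧ (∀ m j, i.Λb m j = {_c | j = m}) ∧ i.η = ((F.L : ℝ)⁻¹) ^ i.k} => (zdGF3 (Matrix (Fin N) (Fin N) ℂ) F.L β len i.1).toGFData2))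
    (C : T4Family → B11Thm1.Consts) (c : T4Family → ℝ) (hc0 : ∀ F, 0 ≤ c F) (hcB : ∀ F, c F ≤ (C F).B₃)
    (hBa : ∀ F, (C F).B₃ * (C F).a₁ ≤ 1 / 64)
    (hK : ∀ (F : T4Family) (k : ℕ) (ε₁ : ℝ), 0 < ε₁ → ε₁ ≤ (C F).a₁ → ∀ (V U : Site 4 → Fin 4 → (MatA N)ˣ),
      V ∈ sfClass 4 F.L (ne3NperOfRecord₁₁ F 0 0) ε₁ 0 →
      IsMinimiser 4 (sfClass 4 F.L (ne3NperOfRecord₁₁ F 0 0) ((C F).B₃ * ε₁)) F.L (ne3NperOfRecord₁₁ F 0 0) (k + 1) V U →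
        ∀ (x : Site 4) (κ : Fin 4) (π : T4AveragingDeficitWall.Plane 4),
          ‖covGrad U (fun q => ((fhol U q : (MatA N)ˣ) : MatA N)) x κ π‖ ≤ c F * ε₁ / ((F.L : ℝ) ^ (k + 1)) ^ 3) :
    ∃ (ℓ₃ : T4Family → NE3Letters₁₁) (g B c' : T4Family → ℝ), (∀ F, 0 < g F) ∧ N16LettersEnd N g ℓ₃ ∧
      (∀ F : T4Family, 0 < B F ∧ (ℓ₃ F).ε / B F ≤ (ℓ₃ F).b) ∧
      (∀ F : T4Family, (C F).B₃ ≤ B F ∧ (2 : ℝ) ^ 78 * (F.L : ℝ) ^ 12 ≤ B F) ∧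
      (∀ F : T4Family, g F = gradConst 4 (c' F) ∧ (ℓ₃ F).g = gradConst 4 (c' F) ∧ 0 ≤ c' F ∧ (ℓ₃ F).b ≤ c' F ∧
        (2 : ℝ) ^ 91 * (F.L : ℝ) ^ 17 * c' F ≤ 1 ∧ (2 : ℝ) ^ 76 * (F.L : ℝ) ^ 12 * c' F ≤ (ℓ₃ F).ε ∧
        16 * C0 4 * (ℓ₃ F).ε ≤ 3 ∧ 1024 * (4 + 1) * (4 + 4) * (F.L : ℝ) ^ 2 * (ℓ₃ F).ε ≤ 1 ∧
        (ℓ₃ F).ε / B F ≤ 1 / 4 ∧ 4 * ((ℓ₃ F).ε / B F) ≤ c' F) ∧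
      ∀ 𝔯 : RateReading₁₃CoPH N, N16PinnedLoose 𝔯 ℓ₃ B → N16HolderAtReading 𝔯 β := by
  have hkey := fun F : T4Family =>
    slotKeyBody_of_supKey (d := 4) (n := Fin N) (N := ne3NperOfRecord₁₁ F 0 0) (by have := F.hL.2; omega) (C F) (hc0 F) (hcB F)
      (hBa F) (hK F)
  choose G hGm hG hR using hkey
  exact exists_letters_g_n16HolderAtReading_loose_squeezeFull_of_h5_reg910Slot hβ0 hβ1 h5 hGm hG C hR

/-- ★ **THE SAME FROM `RegularSup`-TYPE REGULARITY OF THE MINIMISERS** (file 18 `slotKeyBody_of_regularSupKey`): «every minimiser over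
`sfClass ((C F).B₃ε₁) (k+1)` at an `ε₁`-loose datum is `RegularSup 4 F.L Nper (b F) (c′ F·ε₁) (k+1)`», `0 ≤ c′ F`, `2c′ F ≤ (C F).B₃`,
`(C F).B₃·(C F).a₁ ≤ 1∕64`.  Conclusion VERBATIM module 50's. [cite: Balaban1985Variational, Thm 1 (8)–(10) p.279] [folklore] -/
theorem exists_letters_g_n16HolderAtReading_loose_squeezeFull_of_h5_regularSupKey
    (h5 : ∀ F : T4Family, letI : CStarAlgebra (Matrix (Fin N) (Fin N) ℂ) := {}
      ∃ (len : Site 4 → ℝ) (c₁ c₁' B₁' cP C₂ B₀β : ℝ) (inp : B8.B9Inputs),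
        (∀ v : Site 4, 0 < len v → 1 ≤ len v) ∧ (∀ μ : Fin 4, len (e μ) = 1) ∧ 0 < B₁' ∧ 5 * ((4 : ℕ) : ℝ) * F.L * inp.B₀ ≤ B₁' ∧ 0 < c₁' ∧
        (∀ α₀ α₁ : ℝ, 0 < α₀ → 0 < α₁ → α₀ + α₁ ≤ c₁' →
          α₀ + α₁ ≤ c₁ ∧ C0 4 * (2 * α₀) ≤ 1 / 3 ∧ 4 * α₀ ≤ c2' 4 F.L ∧ 16 * (B₁' * (α₀ + α₁)) ≤ 1 ∧
          Real.exp (4 * (800 * (((4 : ℕ) : ℝ) + 1) ^ 2 * (((4 : ℕ) : ℝ) + 4)) * α₀) * (1 + 8 * (131072 * (((4 : ℕ) : ℝ) + 1) ^ 2) * (B₁' * (α₀ + α₁))) ≤ 2 ∧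
          2 * (B₁' * (α₀ + α₁)) ≤ c3 4 F.L ∧ ((4 : ℕ) : ℝ) * F.L * α₁ ≤ 1 / 8 ∧ α₀ ≤ cP ∧ α₁ ≤ cP ∧ B₁' * (α₀ + α₁) ≤ cP ∧
          2 * (B₁' * (α₀ + α₁)) ^ 2 + 20 * ((4 : ℕ) : ℝ) * α₀ * (B₁' * (α₀ + α₁)) + 2 * C₂ * (B₁' * (α₀ + α₁)) ^ 2 ≤ α₀ + α₁) ∧
        B8.Thm4Body c₁ B₁' (fun i : {i : ZdIdx 4 F.L // (∀ j, i.Ω j = Set.univ) ∧ (∀ m j, i.Λs m j = {_y | j = m}) ∧ (∀ m j, i.Λb m j = {_c | j = m}) ∧ i.η = ((F.L : ℝ)⁻¹) ^ i.k} => (zdGF3 (Matrix (Fin N) (Fin N) ℂ) F.L β len i.1).toGFData) ∧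
        B8.Prop3Body cP 4 (F.L : ℝ) C₂ inp B₀β (fun i : {i : ZdIdx 4 F.L // (∀ j, i.Ω j = Set.univ) ∧ (∀ m j, i.Λs m j = {_y | j = m}) ∧ (∀ m j, i.Λb m j = {_c | j = m}) ∧ i.η = ((F.L : ℝ)⁻¹) ^ i.k} => (zdGF3 (Matrix (Fin N) (Fin N) ℂ) F.L β len i.1).toGFData2))
    (C : T4Family → B11Thm1.Consts) (b c' : T4Family → ℝ) (hc0 : ∀ F, 0 ≤ c' F) (hcB : ∀ F, 2 * c' F ≤ (C F).B₃)
    (hBa : ∀ F, (C F).B₃ * (C F).a₁ ≤ 1 / 64)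
    (hR : ∀ (F : T4Family) (k : ℕ) (ε₁ : ℝ), 0 < ε₁ → ε₁ ≤ (C F).a₁ → ∀ (V U : Site 4 → Fin 4 → (MatA N)ˣ),
      V ∈ sfClass 4 F.L (ne3NperOfRecord₁₁ F 0 0) ε₁ 0 →
      IsMinimiser 4 (sfClass 4 F.L (ne3NperOfRecord₁₁ F 0 0) ((C F).B₃ * ε₁)) F.L (ne3NperOfRecord₁₁ F 0 0) (k + 1) V U →
        RegularSup 4 F.L (ne3NperOfRecord₁₁ F 0 0) (b F) (c' F * ε₁) (k + 1) U) :
    ∃ (ℓ₃ : T4Family → NE3Letters₁₁) (g B c' : T4Family → ℝ), (∀ F, 0 < g F) ∧ N16LettersEnd N g ℓ₃ ∧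
      (∀ F : T4Family, 0 < B F ∧ (ℓ₃ F).ε / B F ≤ (ℓ₃ F).b) ∧
      (∀ F : T4Family, (C F).B₃ ≤ B F ∧ (2 : ℝ) ^ 78 * (F.L : ℝ) ^ 12 ≤ B F) ∧
      (∀ F : T4Family, g F = gradConst 4 (c' F) ∧ (ℓ₃ F).g = gradConst 4 (c' F) ∧ 0 ≤ c' F ∧ (ℓ₃ F).b ≤ c' F ∧
        (2 : ℝ) ^ 91 * (F.L : ℝ) ^ 17 * c' F ≤ 1 ∧ (2 : ℝ) ^ 76 * (F.L : ℝ) ^ 12 * c' F ≤ (ℓ₃ F).ε ∧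
        16 * C0 4 * (ℓ₃ F).ε ≤ 3 ∧ 1024 * (4 + 1) * (4 + 4) * (F.L : ℝ) ^ 2 * (ℓ₃ F).ε ≤ 1 ∧
        (ℓ₃ F).ε / B F ≤ 1 / 4 ∧ 4 * ((ℓ₃ F).ε / B F) ≤ c' F) ∧
      ∀ 𝔯 : RateReading₁₃CoPH N, N16PinnedLoose 𝔯 ℓ₃ B → N16HolderAtReading 𝔯 β := by
  have hkey := fun F : T4Family =>
    slotKeyBody_of_regularSupKey (d := 4) (n := Fin N) (N := ne3NperOfRecord₁₁ F 0 0) (by have := F.hL.2; omega) (C F) (b := b F)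
      (hc0 F) (hcB F) (hBa F) (hR F)
  choose G hGm hG hR' using hkey
  exact exists_letters_g_n16HolderAtReading_loose_squeezeFull_of_h5_reg910Slot hβ0 hβ1 h5 hGm hG C hR'

end Producer

/-! ## §2 dag-n16-e's module 52 `…N16Stub1RoadOfSlotKey` RE-KEYED: v6 stub 1's TEXT and K3⁸ BY NAME from `h5` + the SUP KEY + the rows -/

section Rows

variable (β : ℝ) (hβ : 2 / 3 < β) (hβ' : β < 1) (ℓ : LetterReading) (g : T4Family → ℝ) (s : (F : T4Family) → Stage13HParams F 2 → ℕ)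
  -- the U3 letter block's rows
  (hs : ∀ (F : T4Family) (θ : Stage13HParams F 2), θ.Provisos₁₃CoPH F 2 → (θ.ZhUnity F 2 ∧ θ.SlotsNondegenerate₁₃ F 2) → θ.Admissible F 2 → (ℓ F θ).Signs)
  (hκ : ∀ (F : T4Family) (θ : Stage13HParams F 2), θ.Provisos₁₃CoPH F 2 → (θ.ZhUnity F 2 ∧ θ.SlotsNondegenerate₁₃ F 2) → θ.Admissible F 2 → 0 < (ℓ F θ).κ)
  (hcr : ∀ (F : T4Family) (θ : Stage13HParams F 2), θ.Provisos₁₃CoPH F 2 → (θ.ZhUnity F 2 ∧ θ.SlotsNondegenerate₁₃ F 2) → θ.Admissible F 2 → betaPrime510 4 1 (ℓ F θ).κ ≤ (ℓ F θ).cr)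
  (hρ : ∀ (F : T4Family) (θ : Stage13HParams F 2), θ.Provisos₁₃CoPH F 2 → (θ.ZhUnity F 2 ∧ θ.SlotsNondegenerate₁₃ F 2) → θ.Admissible F 2 → 0 ≤ (ℓ F θ).ρ ∧ (ℓ F θ).ρ < 1)
  -- def-W1's four finite-volume kernel letters of record
  (hL : ∀ (F : T4Family) (θ : Stage13HParams F 2), θ.Provisos₁₃CoPH F 2 → (θ.ZhUnity F 2 ∧ θ.SlotsNondegenerate₁₃ F 2) → θ.Admissible F 2 → PolLimitsExistOfRecord₁₃ F 2 θ.toStage13Params)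
  (h9 : ∀ (F : T4Family) (θ : Stage13HParams F 2), θ.Provisos₁₃CoPH F 2 → (θ.ZhUnity F 2 ∧ θ.SlotsNondegenerate₁₃ F 2) → θ.Admissible F 2 →
    WindowedNE9OfRecord₁₃ F 2 θ.toStage13Params (ℓ F θ).κ (ℓ F θ).moduli)
  (hW : ∀ (F : T4Family) (θ : Stage13HParams F 2), θ.Provisos₁₃CoPH F 2 → (θ.ZhUnity F 2 ∧ θ.SlotsNondegenerate₁₃ F 2) → θ.Admissible F 2 →
    WindowedDecayOfRecord₁₃ F 2 θ.toStage13Params 0 1 (ℓ F θ).κ)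
  (hS : ∀ (F : T4Family) (θ : Stage13HParams F 2), θ.Provisos₁₃CoPH F 2 → (θ.ZhUnity F 2 ∧ θ.SlotsNondegenerate₁₃ F 2) → θ.Admissible F 2 →
    WindowedStepRateOfRecord₁₃ F 2 θ.toStage13Params (s F θ) (ℓ F θ).κ (ℓ F θ).θ₅ ((ℓ F θ).C₅ * (ℓ F θ).θ₅))
include hβ hβ' hs hκ hcr hρ hL h9 hW hS

/-- ★★ **v6 STUB 1's TEXT FROM NODE N05's `h5` AND THE SUP KEY, BY NAME** — dag-n16-e's `stub1TextV_of_h5_reg910Slot_match_of_rows` (module 52) with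
its slot-key binders `(G, hGm, hG, C, hR)` REPLACED by constants `C F` (`(C F).B₃·(C F).a₁ ≤ 1∕64`), a letter `0 ≤ c F ≤ (C F).B₃` and the sup key
«at every minimiser `U` of run `k+1` over `sfClass ((C F).B₃ε₁) (k+1)` with an `ε₁`-loose datum (`ε₁ ≤ (C F).a₁`), the covariant plaquette differences are
`≤ c F·ε₁·F.L^{−3(k+1)}`» (node N07's debt in gauge-invariant (8)+(10) currency; DISPLAYED, asserted for nothing): the REGISTERED `stub_rates13HV` text from
`β ∈ ]2∕3, 1[`, a coupling letter `g F > 0`, `h5`, `C`, `c`, the sup key, the U3 letter rows and def-W1's four kernel letters.  One `choose` on file 18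
`slotKeyBody_of_supKey`, then module 52.  NOT a proof of the stub. [cite: Balaban1985Variational, Thm 1 (8)–(10) p.279] [bookkeeping] -/
theorem stub1TextV_of_h5_supKey_match_of_rows (hg : ∀ F, 0 < g F)
    (h5 : ∀ F : T4Family, letI : CStarAlgebra (Matrix (Fin 2) (Fin 2) ℂ) := {}
      ∃ (len : Site 4 → ℝ) (c₁ c₁' B₁' cP C₂ B₀β : ℝ) (inp : B8.B9Inputs),
        (∀ v : Site 4, 0 < len v → 1 ≤ len v) ∧ (∀ μ : Fin 4, len (e μ) = 1) ∧ 0 < B₁' ∧ 5 * ((4 : ℕ) : ℝ) * F.L * inp.B₀ ≤ B₁' ∧ 0 < c₁' ∧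
        (∀ α₀ α₁ : ℝ, 0 < α₀ → 0 < α₁ → α₀ + α₁ ≤ c₁' →
          α₀ + α₁ ≤ c₁ ∧ C0 4 * (2 * α₀) ≤ 1 / 3 ∧ 4 * α₀ ≤ c2' 4 F.L ∧ 16 * (B₁' * (α₀ + α₁)) ≤ 1 ∧
          Real.exp (4 * (800 * (((4 : ℕ) : ℝ) + 1) ^ 2 * (((4 : ℕ) : ℝ) + 4)) * α₀) * (1 + 8 * (131072 * (((4 : ℕ) : ℝ) + 1) ^ 2) * (B₁' * (α₀ + α₁))) ≤ 2 ∧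
          2 * (B₁' * (α₀ + α₁)) ≤ c3 4 F.L ∧ ((4 : ℕ) : ℝ) * F.L * α₁ ≤ 1 / 8 ∧ α₀ ≤ cP ∧ α₁ ≤ cP ∧ B₁' * (α₀ + α₁) ≤ cP ∧
          2 * (B₁' * (α₀ + α₁)) ^ 2 + 20 * ((4 : ℕ) : ℝ) * α₀ * (B₁' * (α₀ + α₁)) + 2 * C₂ * (B₁' * (α₀ + α₁)) ^ 2 ≤ α₀ + α₁) ∧
        B8.Thm4Body c₁ B₁' (fun i : {i : ZdIdx 4 F.L // (∀ j, i.Ω j = Set.univ) ∧ (∀ m j, i.Λs m j = {_y | j = m}) ∧ (∀ m j, i.Λb m j = {_c | j = m}) ∧ i.η = ((F.L : ℝ)⁻¹) ^ i.k} => (zdGF3 (Matrix (Fin 2) (Fin 2) ℂ) F.L β len i.1).toGFData) ∧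
        B8.Prop3Body cP 4 (F.L : ℝ) C₂ inp B₀β (fun i : {i : ZdIdx 4 F.L // (∀ j, i.Ω j = Set.univ) ∧ (∀ m j, i.Λs m j = {_y | j = m}) ∧ (∀ m j, i.Λb m j = {_c | j = m}) ∧ i.η = ((F.L : ℝ)⁻¹) ^ i.k} => (zdGF3 (Matrix (Fin 2) (Fin 2) ℂ) F.L β len i.1).toGFData2))
    (C : T4Family → B11Thm1.Consts) (c : T4Family → ℝ) (hc0 : ∀ F, 0 ≤ c F) (hcB : ∀ F, c F ≤ (C F).B₃)
    (hBa : ∀ F, (C F).B₃ * (C F).a₁ ≤ 1 / 64)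
    (hK : ∀ (F : T4Family) (k : ℕ) (ε₁ : ℝ), 0 < ε₁ → ε₁ ≤ (C F).a₁ → ∀ (V U : Site 4 → Fin 4 → (MatA 2)ˣ),
      V ∈ sfClass 4 F.L (ne3NperOfRecord₁₁ F 0 0) ε₁ 0 →
      IsMinimiser 4 (sfClass 4 F.L (ne3NperOfRecord₁₁ F 0 0) ((C F).B₃ * ε₁)) F.L (ne3NperOfRecord₁₁ F 0 0) (k + 1) V U →
        ∀ (x : Site 4) (κ : Fin 4) (π : T4AveragingDeficitWall.Plane 4),
          ‖covGrad U (fun q => ((fhol U q : (MatA 2)ˣ) : MatA 2)) x κ π‖ ≤ c F * ε₁ / ((F.L : ℝ) ^ (k + 1)) ^ 3) :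
    ∃ β : ℝ, 2 / 3 < β ∧ β < 1 ∧
    ∃ (𝔯 : RateReading₁₃CoPH 2) (ksel : RunSel) (ℓ : LetterReading) (ℓ₃ : T4Family → Node00.NE3Letters₁₁) (g B : T4Family → ℝ),
      GuardedReadingN16 𝔯 ksel ℓ ℓ₃ g B ∧ KeyedRatesHolderD4V β (rrOfRecord 𝔯 ksel) := by
  have hkey := fun F : T4Family =>
    slotKeyBody_of_supKey (d := 4) (n := Fin 2) (N := ne3NperOfRecord₁₁ F 0 0) (by have := F.hL.2; omega) (C F) (hc0 F) (hcB F)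
      (hBa F) (hK F)
  choose G hGm hG hR using hkey
  exact stub1TextV_of_h5_reg910Slot_match_of_rows β hβ hβ' ℓ g s hs hκ hcr hρ hL h9 hW hS hg h5 hGm hG C hR

/-- **K3⁸ BY NAME FROM NODE N05's `h5` + THE SUP KEY + THE ROWS, AND v6 STUB 2's TEXT** (`K3V6Defs.spineGivenEndpointR13SepCoPHV_of_stubTextsV` ∘
`stub1TextV_of_h5_supKey_match_of_rows`) — the sup-key twin of module 52's `spineGivenEndpointR13SepCoPHV_of_h5_reg910Slot_of_rows_of_stub2TextV`.
Every in-edge a HYPOTHESIS; NOT a proof of either stub; K3⁸ OPEN. [cite: Balaban1985Variational, Thm 1 (8)–(10) p.279] [bookkeeping] -/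
theorem spineGivenEndpointR13SepCoPHV_of_h5_supKey_of_rows_of_stub2TextV (hg : ∀ F, 0 < g F)
    (h5 : ∀ F : T4Family, letI : CStarAlgebra (Matrix (Fin 2) (Fin 2) ℂ) := {}
      ∃ (len : Site 4 → ℝ) (c₁ c₁' B₁' cP C₂ B₀β : ℝ) (inp : B8.B9Inputs),
        (∀ v : Site 4, 0 < len v → 1 ≤ len v) ∧ (∀ μ : Fin 4, len (e μ) = 1) ∧ 0 < B₁' ∧ 5 * ((4 : ℕ) : ℝ) * F.L * inp.B₀ ≤ B₁' ∧ 0 < c₁' ∧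
        (∀ α₀ α₁ : ℝ, 0 < α₀ → 0 < α₁ → α₀ + α₁ ≤ c₁' →
          α₀ + α₁ ≤ c₁ ∧ C0 4 * (2 * α₀) ≤ 1 / 3 ∧ 4 * α₀ ≤ c2' 4 F.L ∧ 16 * (B₁' * (α₀ + α₁)) ≤ 1 ∧
          Real.exp (4 * (800 * (((4 : ℕ) : ℝ) + 1) ^ 2 * (((4 : ℕ) : ℝ) + 4)) * α₀) * (1 + 8 * (131072 * (((4 : ℕ) : ℝ) + 1) ^ 2) * (B₁' * (α₀ + α₁))) ≤ 2 ∧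
          2 * (B₁' * (α₀ + α₁)) ≤ c3 4 F.L ∧ ((4 : ℕ) : ℝ) * F.L * α₁ ≤ 1 / 8 ∧ α₀ ≤ cP ∧ α₁ ≤ cP ∧ B₁' * (α₀ + α₁) ≤ cP ∧
          2 * (B₁' * (α₀ + α₁)) ^ 2 + 20 * ((4 : ℕ) : ℝ) * α₀ * (B₁' * (α₀ + α₁)) + 2 * C₂ * (B₁' * (α₀ + α₁)) ^ 2 ≤ α₀ + α₁) ∧
        B8.Thm4Body c₁ B₁' (fun i : {i : ZdIdx 4 F.L // (∀ j, i.Ω j = Set.univ) ∧ (∀ m j, i.Λs m j = {_y | j = m}) ∧ (∀ m j, i.Λb m j = {_c | j = m}) ∧ i.η = ((F.L : ℝ)⁻¹) ^ i.k} => (zdGF3 (Matrix (Fin 2) (Fin 2) ℂ) F.L β len i.1).toGFData) ∧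
        B8.Prop3Body cP 4 (F.L : ℝ) C₂ inp B₀β (fun i : {i : ZdIdx 4 F.L // (∀ j, i.Ω j = Set.univ) ∧ (∀ m j, i.Λs m j = {_y | j = m}) ∧ (∀ m j, i.Λb m j = {_c | j = m}) ∧ i.η = ((F.L : ℝ)⁻¹) ^ i.k} => (zdGF3 (Matrix (Fin 2) (Fin 2) ℂ) F.L β len i.1).toGFData2))
    (C : T4Family → B11Thm1.Consts) (c : T4Family → ℝ) (hc0 : ∀ F, 0 ≤ c F) (hcB : ∀ F, c F ≤ (C F).B₃)
    (hBa : ∀ F, (C F).B₃ * (C F).a₁ ≤ 1 / 64)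
    (hK : ∀ (F : T4Family) (k : ℕ) (ε₁ : ℝ), 0 < ε₁ → ε₁ ≤ (C F).a₁ → ∀ (V U : Site 4 → Fin 4 → (MatA 2)ˣ),
      V ∈ sfClass 4 F.L (ne3NperOfRecord₁₁ F 0 0) ε₁ 0 →
      IsMinimiser 4 (sfClass 4 F.L (ne3NperOfRecord₁₁ F 0 0) ((C F).B₃ * ε₁)) F.L (ne3NperOfRecord₁₁ F 0 0) (k + 1) V U →
        ∀ (x : Site 4) (κ : Fin 4) (π : T4AveragingDeficitWall.Plane 4),
          ‖covGrad U (fun q => ((fhol U q : (MatA 2)ˣ) : MatA 2)) x κ π‖ ≤ c F * ε₁ / ((F.L : ℝ) ^ (k + 1)) ^ 3)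
    (h₂ : ∀ β : ℝ, 2 / 3 < β → β < 1 →
    ∀ (𝔯 : RateReading₁₃CoPH 2) (ksel : RunSel) (ℓ : LetterReading) (ℓ₃ : T4Family → Node00.NE3Letters₁₁) (g B : T4Family → ℝ),
      GuardedReadingN16 𝔯 ksel ℓ ℓ₃ g B → KeyedRatesHolderD4V β (rrOfRecord 𝔯 ksel) →
      ∃ (jc : CutReading) (sh : ShellSplit₁₃CoPH 2 0) (cr : SpineReading), PinnedAtLive jc sh cr ∧
        KeyedRelWeight cr ∧ KeyedShellWeight cr ∧ KeyedExtractionV cr ∧ KeyedCoreEdgeHolderD4V β cr (rrOfRecord 𝔯 ksel)) :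
    Summit.QuantumFields.YangMills.Theses.BalabanUVNodes.SpineGivenEndpointR13SepCoPHV :=
  spineGivenEndpointR13SepCoPHV_of_stubTextsV
    (stub1TextV_of_h5_supKey_match_of_rows β hβ hβ' ℓ g s hs hκ hcr hρ hL h9 hW hS hg h5 C c hc0 hcB hBa hK) h₂

end Rows

section RowsNoG

variable (β : ℝ) (hβ : 2 / 3 < β) (hβ' : β < 1) (ℓ : LetterReading) (s : (F : T4Family) → Stage13HParams F 2 → ℕ)
  -- the U3 letter block's rows
  (hs : ∀ (F : T4Family) (θ : Stage13HParams F 2), θ.Provisos₁₃CoPH F 2 → (θ.ZhUnity F 2 ∧ θ.SlotsNondegenerate₁₃ F 2) → θ.Admissible F 2 → (ℓ F θ).Signs)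
  (hκ : ∀ (F : T4Family) (θ : Stage13HParams F 2), θ.Provisos₁₃CoPH F 2 → (θ.ZhUnity F 2 ∧ θ.SlotsNondegenerate₁₃ F 2) → θ.Admissible F 2 → 0 < (ℓ F θ).κ)
  (hcr : ∀ (F : T4Family) (θ : Stage13HParams F 2), θ.Provisos₁₃CoPH F 2 → (θ.ZhUnity F 2 ∧ θ.SlotsNondegenerate₁₃ F 2) → θ.Admissible F 2 → betaPrime510 4 1 (ℓ F θ).κ ≤ (ℓ F θ).cr)
  (hρ : ∀ (F : T4Family) (θ : Stage13HParams F 2), θ.Provisos₁₃CoPH F 2 → (θ.ZhUnity F 2 ∧ θ.SlotsNondegenerate₁₃ F 2) → θ.Admissible F 2 → 0 ≤ (ℓ F θ).ρ ∧ (ℓ F θ).ρ < 1)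
  -- def-W1's four finite-volume kernel letters of record
  (hL : ∀ (F : T4Family) (θ : Stage13HParams F 2), θ.Provisos₁₃CoPH F 2 → (θ.ZhUnity F 2 ∧ θ.SlotsNondegenerate₁₃ F 2) → θ.Admissible F 2 → PolLimitsExistOfRecord₁₃ F 2 θ.toStage13Params)
  (h9 : ∀ (F : T4Family) (θ : Stage13HParams F 2), θ.Provisos₁₃CoPH F 2 → (θ.ZhUnity F 2 ∧ θ.SlotsNondegenerate₁₃ F 2) → θ.Admissible F 2 →
    WindowedNE9OfRecord₁₃ F 2 θ.toStage13Params (ℓ F θ).κ (ℓ F θ).moduli)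
  (hW : ∀ (F : T4Family) (θ : Stage13HParams F 2), θ.Provisos₁₃CoPH F 2 → (θ.ZhUnity F 2 ∧ θ.SlotsNondegenerate₁₃ F 2) → θ.Admissible F 2 →
    WindowedDecayOfRecord₁₃ F 2 θ.toStage13Params 0 1 (ℓ F θ).κ)
  (hS : ∀ (F : T4Family) (θ : Stage13HParams F 2), θ.Provisos₁₃CoPH F 2 → (θ.ZhUnity F 2 ∧ θ.SlotsNondegenerate₁₃ F 2) → θ.Admissible F 2 →
    WindowedStepRateOfRecord₁₃ F 2 θ.toStage13Params (s F θ) (ℓ F θ).κ (ℓ F θ).θ₅ ((ℓ F θ).C₅ * (ℓ F θ).θ₅))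
include hβ hβ' hs hκ hcr hρ hL h9 hW hS

/-- ★★ **v6 STUB 1's TEXT FROM `h5` AND THE SUP KEY WITH THE SQUEEZED LETTERS** — module 52's `stub1TextV_of_h5_reg910Slot_squeeze_of_rows` re-keyed the
same way: no coupling-letter input (`g := gradConst 4 ∘ c′` OUTPUT by module 50, letters meeting node N19′'s nine N16-letter rows and the floor).
NOT a proof of the stub. [cite: Balaban1985Variational, Thm 1 (8)–(10) p.279] [bookkeeping] -/
theorem stub1TextV_of_h5_supKey_squeeze_of_rows
    (h5 : ∀ F : T4Family, letI : CStarAlgebra (Matrix (Fin 2) (Fin 2) ℂ) := {}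
      ∃ (len : Site 4 → ℝ) (c₁ c₁' B₁' cP C₂ B₀β : ℝ) (inp : B8.B9Inputs),
        (∀ v : Site 4, 0 < len v → 1 ≤ len v) ∧ (∀ μ : Fin 4, len (e μ) = 1) ∧ 0 < B₁' ∧ 5 * ((4 : ℕ) : ℝ) * F.L * inp.B₀ ≤ B₁' ∧ 0 < c₁' ∧
        (∀ α₀ α₁ : ℝ, 0 < α₀ → 0 < α₁ → α₀ + α₁ ≤ c₁' →
          α₀ + α₁ ≤ c₁ ∧ C0 4 * (2 * α₀) ≤ 1 / 3 ∧ 4 * α₀ ≤ c2' 4 F.L ∧ 16 * (B₁' * (α₀ + α₁)) ≤ 1 ∧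
          Real.exp (4 * (800 * (((4 : ℕ) : ℝ) + 1) ^ 2 * (((4 : ℕ) : ℝ) + 4)) * α₀) * (1 + 8 * (131072 * (((4 : ℕ) : ℝ) + 1) ^ 2) * (B₁' * (α₀ + α₁))) ≤ 2 ∧
          2 * (B₁' * (α₀ + α₁)) ≤ c3 4 F.L ∧ ((4 : ℕ) : ℝ) * F.L * α₁ ≤ 1 / 8 ∧ α₀ ≤ cP ∧ α₁ ≤ cP ∧ B₁' * (α₀ + α₁) ≤ cP ∧
          2 * (B₁' * (α₀ + α₁)) ^ 2 + 20 * ((4 : ℕ) : ℝ) * α₀ * (B₁' * (α₀ + α₁)) + 2 * C₂ * (B₁' * (α₀ + α₁)) ^ 2 ≤ α₀ + α₁) ∧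
        B8.Thm4Body c₁ B₁' (fun i : {i : ZdIdx 4 F.L // (∀ j, i.Ω j = Set.univ) ∧ (∀ m j, i.Λs m j = {_y | j = m}) ∧ (∀ m j, i.Λb m j = {_c | j = m}) ∧ i.η = ((F.L : ℝ)⁻¹) ^ i.k} => (zdGF3 (Matrix (Fin 2) (Fin 2) ℂ) F.L β len i.1).toGFData) ∧
        B8.Prop3Body cP 4 (F.L : ℝ) C₂ inp B₀β (fun i : {i : ZdIdx 4 F.L // (∀ j, i.Ω j = Set.univ) ∧ (∀ m j, i.Λs m j = {_y | j = m}) ∧ (∀ m j, i.Λb m j = {_c | j = m}) ∧ i.η = ((F.L : ℝ)⁻¹) ^ i.k} => (zdGF3 (Matrix (Fin 2) (Fin 2) ℂ) F.L β len i.1).toGFData2))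
    (C : T4Family → B11Thm1.Consts) (c : T4Family → ℝ) (hc0 : ∀ F, 0 ≤ c F) (hcB : ∀ F, c F ≤ (C F).B₃)
    (hBa : ∀ F, (C F).B₃ * (C F).a₁ ≤ 1 / 64)
    (hK : ∀ (F : T4Family) (k : ℕ) (ε₁ : ℝ), 0 < ε₁ → ε₁ ≤ (C F).a₁ → ∀ (V U : Site 4 → Fin 4 → (MatA 2)ˣ),
      V ∈ sfClass 4 F.L (ne3NperOfRecord₁₁ F 0 0) ε₁ 0 →
      IsMinimiser 4 (sfClass 4 F.L (ne3NperOfRecord₁₁ F 0 0) ((C F).B₃ * ε₁)) F.L (ne3NperOfRecord₁₁ F 0 0) (k + 1) V U →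
        ∀ (x : Site 4) (κ : Fin 4) (π : T4AveragingDeficitWall.Plane 4),
          ‖covGrad U (fun q => ((fhol U q : (MatA 2)ˣ) : MatA 2)) x κ π‖ ≤ c F * ε₁ / ((F.L : ℝ) ^ (k + 1)) ^ 3) :
    ∃ β : ℝ, 2 / 3 < β ∧ β < 1 ∧
    ∃ (𝔯 : RateReading₁₃CoPH 2) (ksel : RunSel) (ℓ : LetterReading) (ℓ₃ : T4Family → Node00.NE3Letters₁₁) (g B : T4Family → ℝ),
      GuardedReadingN16 𝔯 ksel ℓ ℓ₃ g B ∧ KeyedRatesHolderD4V β (rrOfRecord 𝔯 ksel) := by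
  have hkey := fun F : T4Family =>
    slotKeyBody_of_supKey (d := 4) (n := Fin 2) (N := ne3NperOfRecord₁₁ F 0 0) (by have := F.hL.2; omega) (C F) (hc0 F) (hcB F)
      (hBa F) (hK F)
  choose G hGm hG hR using hkey
  exact stub1TextV_of_h5_reg910Slot_squeeze_of_rows β hβ hβ' ℓ s hs hκ hcr hρ hL h9 hW hS h5 hGm hG C hR

end RowsNoG

end

end Summit.QuantumFields.YangMills.BalabanUVNodes.N16SupKeyRoads
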